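import Summits.SmoothPoincare4.SmoothPoincare4.Theses.SymplecticOrigami
import Summits.SmoothPoincare4.SmoothPoincare4.Theorems.SymplecticOrigamiOrigamiFoldExistenceStubChartEmbedding
import Literature.Topology.FourManifolds.HomotopySpheres
import Literature.Topology.FourManifolds.SmoothOrientationSphereProofs

/-!
# Line `stable-seam-host` (crux `OrigamiFoldExistence`, stmt-SmoothPoincare4-7844): STUB 1 forces the formal host package

Registered helper `helper_hostPackage_of_hostEmbedding` (worker A's certificate, wave 1 of lead c8): the
registered STUB 1 `stub_hostEmbedding` of the line — "the fake ball of every homotopy 4-sphere embeds in a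
closed simply connected symplectic `ℝ⁴`-charted `(X, Ω)` carrying an `Ω`-symplectic embedded round 2-sphere
with a disjoint homotopic embedded push-off" (signature inlined verbatim) — implies, by instantiating at the
round `S⁴` (a `HomotopySphere 4` for any of its smooth orientations, `isOrientable_sphere_holds`) and a chart
ball (landed `stub_chartEmbedding`, p87331) and forgetting `S, e, J`, the bare existence of such a host
package (in print: `S² × S²` with `σ ⊕ σ`; by McDuff 1990 any such `X` is a rational surface other than
`ℂℙ²`).  So no proof of STUB 1 can avoid constructing that package, which the tree does not yet have
(ℂℙⁿ with `fubiniStudyMFormCP` is the only closed symplectic `MForm` host, and `ℂℙ²` has no square-zero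
class) — the formal floor of STUB 1, recorded for the planner (`work/stubs/stub_hostEmbedding-report.md` of
the seat).  No definitions, no named facts, no `sorry`.
-/

noncomputable section

-- the prescribed namespace `Summit.<P>.<Sub>.…` duplicates `SmoothPoincare4` (P = Sub)
set_option linter.dupNamespace false

open scoped Manifold ContDiff Topology RealInnerProductSpace
open Set Function

namespace Summit.SmoothPoincare4.SmoothPoincare4.Theorems.OrigamiFoldExistence.StableSeamHost

/-- **STUB 1 forces the formal host package** (closed simply connected symplectic `(X, Ω)` with a square-zero
symplectic sphere pair): instantiate the registered statement at the round `S⁴` and a chart ball, forget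
`S`, `e`, `J`. [folklore] -/
theorem helper_hostPackage_of_hostEmbedding :
    (∀ (S : Literature.Topology.FourManifolds.HomotopySphere 4) (e : EuclideanSpace ℝ (Fin 4) → S.carrier), Manifold.IsSmoothEmbedding (𝓡 4) (𝓡 4) ∞ e → ∃ (X : Type) (_ : TopologicalSpace X) (_ : T2Space X) (_ : SecondCountableTopology X) (_ : CompactSpace X) (_ : ChartedSpace (EuclideanSpace ℝ (Fin 4)) X) (_ : IsManifold (𝓡 4) ∞ X) (_ : SimplyConnectedSpace X) (Ω : Literature.Geometry.Kaehler.MForm (𝓡 4) X ℝ 2) (J : S.carrier → X) (c c' : (Metric.sphere (0 : EuclideanSpace ℝ (Fin 3)) 1) → X), (Literature.Geometry.Kaehler.IsSmoothForm Ω ∧ Literature.Geometry.Kaehler.IsClosedForm Ω ∧ ∀ x (v : TangentSpace (𝓡 4) x), v ≠ 0 → ∃ w, Ω x ![v, w] ≠ 0) ∧ (∃ U : Set S.carrier, IsOpen U ∧ (e '' Metric.ball (0 : EuclideanSpace ℝ (Fin 4)) 1)ᶜ ⊆ U ∧ ContMDiffOn (𝓡 4) (𝓡 4) ∞ J U ∧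 Set.InjOn J U ∧ ∀ x ∈ U, Function.Bijective (mfderiv (𝓡 4) (𝓡 4) J x)) ∧ (Manifold.IsSmoothEmbedding (𝓡 2) (𝓡 4) ∞ c ∧ (∀ y (v : TangentSpace (𝓡 2) y), v ≠ 0 → ∃ w : TangentSpace (𝓡 2) y, Ω (c y) ![mfderiv (𝓡 2) (𝓡 4) c y v, mfderiv (𝓡 2) (𝓡 4) c y w] ≠ 0) ∧ Manifold.IsSmoothEmbedding (𝓡 2) (𝓡 4) ∞ c' ∧ Disjoint (Set.range c) (Set.range c') ∧ ∃ H : unitInterval × (Metric.sphere (0 : EuclideanSpace ℝ (Fin 3)) 1) → X, Continuous H ∧ ∀ y, H (0, y) = c y ∧ H (1, y) = c' y)) → ∃ (X : Type) (_ : TopologicalSpace X) (_ : T2Space X) (_ : SecondCountableTopology X) (_ : CompactSpace X) (_ : ChartedSpace (EuclideanSpace ℝ (Fin 4)) X) (_ : IsManifold (𝓡 4) ∞ X) (_ : SimplyConnectedSpace X) (Ω : Literature.Geometry.Kaehler.MForm (𝓡 4) X ℝ 2) (c c' : (Metric.sphere (0 : EuclideanSpace ℝ (Fin 3)) 1) →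 X), (Literature.Geometry.Kaehler.IsSmoothForm Ω ∧ Literature.Geometry.Kaehler.IsClosedForm Ω ∧ ∀ x (v : TangentSpace (𝓡 4) x), v ≠ 0 → ∃ w, Ω x ![v, w] ≠ 0) ∧ (Manifold.IsSmoothEmbedding (𝓡 2) (𝓡 4) ∞ c ∧ (∀ y (v : TangentSpace (𝓡 2) y), v ≠ 0 → ∃ w : TangentSpace (𝓡 2) y, Ω (c y) ![mfderiv (𝓡 2) (𝓡 4) c y v, mfderiv (𝓡 2) (𝓡 4) c y w] ≠ 0) ∧ Manifold.IsSmoothEmbedding (𝓡 2) (𝓡 4) ∞ c' ∧ Disjoint (Set.range c) (Set.range c') ∧ ∃ H : unitInterval × (Metric.sphere (0 : EuclideanSpace ℝ (Fin 3)) 1) → X, Continuous H ∧ ∀ y, H (0, y) = c y ∧ H (1, y) = c' y) := by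
  intro h
  obtain ⟨o⟩ := (Literature.Topology.FourManifolds.isOrientable_sphere_holds 4 :
    Nonempty (Literature.Topology.FourManifolds.SmoothOrientation (𝓡 4)
      (Metric.sphere (0 : EuclideanSpace ℝ (Fin 5)) 1)))
  let S : Literature.Topology.FourManifolds.HomotopySphere 4 :=
    ⟨Metric.sphere (0 : EuclideanSpace ℝ (Fin 5)) 1, o, ⟨.refl _⟩⟩
  obtain ⟨e, he⟩ :=
    Summit.SmoothPoincare4.SmoothPoincare4.Theorems.OrigamiFoldExistence.RoundTraceContinuity.stub_chartEmbedding S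
  obtain ⟨X, i1, i2, i3, i4, i5, i6, i7, Ω, _J, c, c', hΩ, -, hc⟩ := h S e he
  exact ⟨X, i1, i2, i3, i4, i5, i6, i7, Ω, c, c', hΩ, hc⟩

end Summit.SmoothPoincare4.SmoothPoincare4.Theorems.OrigamiFoldExistence.StableSeamHost

end
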